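import Mathlib

/-!
# Carry pattern of the input-bit flip `N ↦ N + p·2^b` (stub `stub_carryPattern`)

The stub `stub_carryPattern` of the crux `MobiusLadder.QuadraticDigitPhases`
(stmt-QuantumAdvantage-1391), line `Sketch`, with its lemmas.  Mathlib only.

For odd `p` with `2^e ≤ p < 2^(e+1)`, a position `b` and any coefficient column
`ρ : ℕ → ZMod 2` with `ρ b = 1`, there is a window value `u < 2^(e+2)` such that for every `N`
whose digits in positions `[b, b+e+2)` spell `u`, the XOR pattern of `N + p·2^b` against `N` is
confined to `[b, b+e+2)` and has `ρ`-weight `1`.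

Proof.  Writing `N = 2^b (2^(e+2) hi + u) + lo` with `lo < 2^b`, if `u + p < 2^(e+2)` then
`N + p 2^b = 2^b (2^(e+2) hi + (u + p)) + lo`, so only the window changes, by the pattern
`(u + p) ⊕ u`.  It remains to find `u` with `u + p < 2^(e+2)` and
`∑_{i < e+2, bit i of (u+p) ≠ bit i of u} σ i = 1` for `σ i := ρ (b + i)`, `σ 0 = 1`.
Take the three candidates `u₁ = 0`, `u₂ = 2^(e+1) - p`, `u₃ = 2^(e+1) - (p+1)/2`:
`u₁ + p = p`, `u₂ + p = 2^(e+1)`, `u₃ + p = 2^(e+1) + (p-1)/2`, and (with `p = 2k+1`,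
`Nat.testBit_two_pow_sub_succ`) position `0` is flipped by all three, each position
`1 ≤ i ≤ e` by `u₃` and by exactly one of `u₁, u₂` (the bits of `p` and of `2^(e+1) - p`
are complementary there), and position `e+1` by `u₂` and `u₃`.  Hence the three weights add
up to `σ 0 = 1` in `ZMod 2`, so one of them equals `1`.
-/

set_option linter.dupNamespace false -- D-0017: single-problem summit ⇒ `QuantumAdvantage.QuantumAdvantage` by design

namespace Summit.QuantumAdvantage.QuantumAdvantage.Theorems.MobiusLadderQuadraticDigitPhasesStubCarryPattern

open Finset

/-- Pointwise flip count of the three candidates `0`, `2^(e+1) - (2k+1)`, `2^(e+1) - (k+1)`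
for `p = 2k+1 < 2^(e+1)`: the `σ`-weighted flips at position `i < e+2` add up (in `ZMod 2`)
to `σ 0` at `i = 0` and to `0` elsewhere. -/
theorem flips_pointwise (k e : ℕ) (hk : 2 * k + 1 < 2 ^ (e + 1)) (σ : ℕ → ZMod 2) (i : ℕ)
    (hi : i < e + 2) :
    (if Nat.testBit (0 + (2 * k + 1)) i = Nat.testBit 0 i then (0 : ZMod 2) else σ i) +
      (if Nat.testBit (2 ^ (e + 1) - (2 * k + 1) + (2 * k + 1)) i =
          Nat.testBit (2 ^ (e + 1) - (2 * k + 1)) i then (0 : ZMod 2) else σ i) +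
      (if Nat.testBit (2 ^ (e + 1) - (k + 1) + (2 * k + 1)) i =
          Nat.testBit (2 ^ (e + 1) - (k + 1)) i then (0 : ZMod 2) else σ i) =
    if i = 0 then σ i else 0 := by
  have hss : ∀ x : ZMod 2, x + x = 0 := by decide
  have hk' : k < 2 ^ (e + 1) := by omega
  have h2k : 2 * k < 2 ^ (e + 1) := by omega
  have e1 : 2 ^ (e + 1) - (2 * k + 1) + (2 * k + 1) = 2 ^ (e + 1) := by omega
  have e2 : 2 ^ (e + 1) - (k + 1) + (2 * k + 1) = 2 ^ (e + 1) * 1 + k := by omega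
  rw [Nat.zero_add, e1, e2, Nat.testBit_two_pow_sub_succ h2k, Nat.testBit_two_pow_sub_succ hk',
    Nat.testBit_two_pow_mul_add _ hk', Nat.testBit_two_pow, Nat.zero_testBit]
  rcases Nat.lt_or_ge i (e + 1) with hlt | hge
  · cases i with
    | zero =>
      have b1 : Nat.testBit (2 * k + 1) 0 = true := by
        rw [Nat.testBit_zero, decide_eq_true_eq]; omega
      have b2 : Nat.testBit (2 * k) 0 = false := by
        rw [Nat.testBit_zero, decide_eq_false_iff_not]; omega
      rw [b1, b2]
      simp [hss]
    | succ j =>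
      have b1 : Nat.testBit (2 * k + 1) (j + 1) = Nat.testBit k j := by
        rw [Nat.testBit_add_one, show (2 * k + 1) / 2 = k by omega]
      have b2 : Nat.testBit (2 * k) (j + 1) = Nat.testBit k j := by
        rw [Nat.testBit_add_one, show 2 * k / 2 = k by omega]
      have hne' : ¬ (e = j) := by omega
      rw [b1, b2, if_pos hlt]
      cases Nat.testBit k j <;> simp [hlt, hne', hss]
  · obtain rfl : i = e + 1 := by omega
    have b1 : Nat.testBit (2 * k + 1) (e + 1) = false := Nat.testBit_lt_two_pow hk
    rw [b1]
    simp [hss]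

/-- **Core.**  For odd `p < 2^(e+1)` and `σ 0 = 1` there is a window value `u` without carry
out (`u + p < 2^(e+2)`) whose flip pattern `(u + p) ⊕ u` has `σ`-weight `1`. -/
theorem exists_window (p e : ℕ) (hp : Odd p) (hpe : p < 2 ^ (e + 1)) (σ : ℕ → ZMod 2)
    (hσ : σ 0 = 1) :
    ∃ u : ℕ, u + p < 2 ^ (e + 2) ∧
      ∑ i ∈ Finset.range (e + 2),
        (if Nat.testBit (u + p) i = Nat.testBit u i then (0 : ZMod 2) else σ i) = 1 := by
  obtain ⟨k, rfl⟩ := hp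
  have hpow : 2 ^ (e + 2) = 2 * 2 ^ (e + 1) := by ring
  have hsum : (∑ i ∈ range (e + 2),
        (if Nat.testBit (0 + (2 * k + 1)) i = Nat.testBit 0 i then (0 : ZMod 2) else σ i)) +
      (∑ i ∈ range (e + 2),
        (if Nat.testBit (2 ^ (e + 1) - (2 * k + 1) + (2 * k + 1)) i =
            Nat.testBit (2 ^ (e + 1) - (2 * k + 1)) i then (0 : ZMod 2) else σ i)) +
      (∑ i ∈ range (e + 2),
        (if Nat.testBit (2 ^ (e + 1) - (k + 1) + (2 * k + 1)) i =
            Nat.testBit (2 ^ (e + 1) - (k + 1)) i then (0 : ZMod 2) else σ i)) = 1 := by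
    rw [← sum_add_distrib, ← sum_add_distrib,
      sum_congr rfl (fun i hi => flips_pointwise k e hpe σ i (mem_range.mp hi)), sum_ite_eq',
      if_pos (mem_range.mpr (by omega))]
    exact hσ
  have h01 : ∀ x y z : ZMod 2, x + y + z = 1 → x = 1 ∨ y = 1 ∨ z = 1 := by decide
  rcases h01 _ _ _ hsum with h1 | h1 | h1
  · exact ⟨0, by omega, h1⟩
  · exact ⟨2 ^ (e + 1) - (2 * k + 1), by omega, h1⟩
  · exact ⟨2 ^ (e + 1) - (k + 1), by omega, h1⟩

/-- Bits of a three-block number `2^b (2^w hi + m) + lo` with `m < 2^w`, `lo < 2^b`: the low block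
`lo` on `[0, b)`, the window `m` on `[b, b+w)`, and `hi` above. -/
theorem testBit_blocks (b w hi m lo i : ℕ) (hm : m < 2 ^ w) (hlo : lo < 2 ^ b) :
    Nat.testBit (2 ^ b * (2 ^ w * hi + m) + lo) i =
      if i < b then Nat.testBit lo i
      else if i - b < w then Nat.testBit m (i - b) else Nat.testBit hi (i - b - w) := by
  rw [Nat.testBit_two_pow_mul_add _ hlo, Nat.testBit_two_pow_mul_add _ hm]

/-- **Carry pattern** (stub `stub_carryPattern`).  For odd `p ≥ 3` with `2^e ≤ p < 2^(e+1)`, a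
position `b` and a column `ρ` with `ρ b = 1`, some window value `u < 2^(e+2)` of the digits of `N`
in positions `[b, b+e+2)` confines the XOR pattern of `N + p·2^b` against `N` to that window and
gives it `ρ`-weight `1`. -/
theorem stub_carryPattern :
    ∀ p : ℕ, Odd p → 3 ≤ p → ∀ e : ℕ, 2 ^ e ≤ p → p < 2 ^ (e + 1) →
      ∀ b : ℕ, ∀ ρ : ℕ → ZMod 2, ρ b = 1 →
      ∃ u : ℕ, u < 2 ^ (e + 2) ∧ ∀ N : ℕ, N / 2 ^ b % 2 ^ (e + 2) = u →
        (∀ i : ℕ, b + (e + 2) ≤ i → (Nat.testBit (N + p * 2 ^ b) i ↔ Nat.testBit N i)) ∧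
        (∀ i : ℕ, i < b → (Nat.testBit (N + p * 2 ^ b) i ↔ Nat.testBit N i)) ∧
        ∑ i ∈ Finset.range (b + (e + 2)),
          (if Nat.testBit (N + p * 2 ^ b) i = Nat.testBit N i then (0 : ZMod 2) else ρ i) = 1 := by
  intro p hp _h3 e _he hpe b ρ hρ
  obtain ⟨u, hup, hsum⟩ :=
    exists_window p e hp hpe (fun h => ρ (b + h)) (show ρ (b + 0) = 1 by rw [add_zero]; exact hρ)
  have hu : u < 2 ^ (e + 2) := by omega
  refine ⟨u, hu, fun N hN => ?_⟩
  obtain ⟨lo, hi, hlo, rfl⟩ :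
      ∃ lo hi : ℕ, lo < 2 ^ b ∧ N = 2 ^ b * (2 ^ (e + 2) * hi + u) + lo :=
    ⟨N % 2 ^ b, N / 2 ^ b / 2 ^ (e + 2), Nat.mod_lt _ (by positivity), by
      rw [← hN, Nat.div_add_mod, Nat.div_add_mod]⟩
  have hNp : 2 ^ b * (2 ^ (e + 2) * hi + u) + lo + p * 2 ^ b =
      2 ^ b * (2 ^ (e + 2) * hi + (u + p)) + lo := by ring
  have hA : ∀ i, Nat.testBit (2 ^ b * (2 ^ (e + 2) * hi + u) + lo + p * 2 ^ b) i =
      (if i < b then Nat.testBit lo i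
        else if i - b < e + 2 then Nat.testBit (u + p) (i - b)
        else Nat.testBit hi (i - b - (e + 2))) := fun i => by
    rw [hNp]; exact testBit_blocks b (e + 2) hi (u + p) lo i hup hlo
  have hB : ∀ i, Nat.testBit (2 ^ b * (2 ^ (e + 2) * hi + u) + lo) i =
      (if i < b then Nat.testBit lo i
        else if i - b < e + 2 then Nat.testBit u (i - b)
        else Nat.testBit hi (i - b - (e + 2))) := fun i =>
    testBit_blocks b (e + 2) hi u lo i hu hlo
  refine ⟨fun i hi' => ?_, fun i hi' => ?_, ?_⟩
  · have h1 : ¬ (i < b) := by omega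
    have h2 : ¬ (i - b < e + 2) := by omega
    rw [hA, hB, if_neg h1, if_neg h1, if_neg h2, if_neg h2]
  · rw [hA, hB, if_pos hi', if_pos hi']
  · have h0 : ∑ x ∈ range b,
        (if Nat.testBit (2 ^ b * (2 ^ (e + 2) * hi + u) + lo + p * 2 ^ b) x =
            Nat.testBit (2 ^ b * (2 ^ (e + 2) * hi + u) + lo) x then (0 : ZMod 2) else ρ x) =
        0 := by
      refine sum_eq_zero (fun x hx => ?_)
      rw [mem_range] at hx
      rw [hA, hB, if_pos hx, if_pos hx, if_pos rfl]
    rw [sum_range_add, h0, zero_add]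
    refine Eq.trans (sum_congr rfl (fun x hx => ?_)) hsum
    rw [mem_range] at hx
    have h1 : ¬ (b + x < b) := by omega
    have h2 : b + x - b = x := by omega
    rw [hA, hB, if_neg h1, if_neg h1, h2, if_pos hx, if_pos hx]
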